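import Summits.RiemannHypothesis.RiemannHypothesis.Theorems.Splittings.JensenDegenerateCriticalSigns

/-!
# Splittings / Jensen — the DEGENERATE-CRITICAL-POINT witness `G_{c,K}` — FILE 4/4: THE PACKAGED WITNESS AND THE REFUTED SCHEMATA (§9–§13)

Carve of `HOME/rh-split-jen-neg/g8/stage/JensenDegenerateCritical.lean` (6de8f964827225eb); definitions and the full
mathematical header live in `JensenDegenerateCriticalDefs.lean`; declaration blocks byte-identical to the stage file.

Contents: §9 NON-STRICT Laguerre at level 0, degenerate at `-c₀`; §10 a non-real zero, zeros of all `G^{(l+1)}` real,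
STRICT Laguerre at levels `≥ 1`; §11 infinitely many real zeros; §12 Jensen rows `n ≥ 1` hyperbolic, `¬ AllHyperbolic`;
§13 `degenerateShadowWitness`, `not_nonStrictLaguerre_implies_realZeros`,
`not_rowsFromOne_and_nonStrictLaguerre_implies_allHyperbolic` (class-level: strictness in `X-4`/`T18` is load-bearing).
HONEST LABEL: class-level evidence about a SPLITTING of a kernel-typed RH-equivalence; nothing here bears on the truth of RH.
-/

set_option linter.dupNamespace false

namespace Summit.RiemannHypothesis.RiemannHypothesis.Theorems.Splittings.JensenDegenerateCritical

open Complex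
open scoped Real ComplexConjugate Nat
open Literature.Barriers.RiemannHypothesis
open Literature.NumberTheory.LFunctions (jensenPoly exists_sq_eq iteratedDeriv_conj_of_conj)
open Literature.Analysis.TotalPositivity (IsEntireOfOrderLtOne)
open Literature.Analysis.Complex (IsEntireOfOrderLt HasNoFourierCriticalPoint)
open Summit.RiemannHypothesis.RiemannHypothesis.Theorems.Splittings.JensenMixedSplit

/-! ## §9 The real trace `g(t) = Re G(t)`: NON-STRICT Laguerre at level 0, degenerate at `-c₀` -/

/-- Level 0 on the complex side: at a real critical point `x` of `G` with `G(x) ≠ 0`,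
`G(x)·G''(x) ≤ 0`, with equality iff `x = -c₀`. -/
theorem laguerre_le_level_zero (x : ℝ) (h1 : deriv (G c₀ K₀) x = 0) :
    (G c₀ K₀ x).re * (deriv (deriv (G c₀ K₀)) x).re ≤ 0 := by
  rcases (deriv_G_ofReal_eq_zero_iff c₀ K₀ x).1 h1 with rfl | ⟨j, rfl⟩
  · push_cast; rw [deriv_deriv_G_neg_c]; simp
  · have := laguerre_sea j; push_cast at this ⊢; exact this.le

/-- **The degenerate critical point**: `g'(-c₀) = 0`, `g''(-c₀) = 0`, `g(-c₀) > 0`. -/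
theorem degenerate_point :
    deriv (fun t : ℝ ↦ (G c₀ K₀ t).re) (-c₀) = 0 ∧
    iteratedDeriv 2 (fun t : ℝ ↦ (G c₀ K₀ t).re) (-c₀) = 0 ∧
    0 < (G c₀ K₀ ((-c₀ : ℝ) : ℂ)).re := by
  have hd := differentiable_G c₀ K₀
  refine ⟨?_, ?_, ?_⟩
  · rw [← iteratedDeriv_one, Literature.Analysis.Complex.KiKim.iteratedDeriv_re_ofReal hd]
    simp only [iteratedDeriv_one]; push_cast; rw [deriv_G_neg_c]; rfl
  · rw [Literature.Analysis.Complex.KiKim.iteratedDeriv_re_ofReal hd]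
    simp only [iteratedDeriv_succ, iteratedDeriv_zero]; push_cast; rw [deriv_deriv_G_neg_c]; rfl
  · push_cast; exact re_G_neg_c₀_pos

/-- So the trace HAS a Fourier critical point (the strict hereditary Laguerre condition fails at
level `0`, point `-c₀`). -/
theorem not_hasNoFourierCriticalPoint_trace :
    ¬ HasNoFourierCriticalPoint (fun t : ℝ ↦ (G c₀ K₀ t).re) := by
  intro h
  obtain ⟨h1, h2, h0⟩ := degenerate_point
  have := h 0 (-c₀) (by simpa using h1) (by simpa using h0.ne')
  rw [zero_add, h2, mul_zero] at this
  exact lt_irrefl 0 this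

/-! ## §10 A non-real zero; zeros of all `G^{(l+1)}` real; STRICT Laguerre at levels `≥ 1` -/

/-- **`G_{c₀,K₀}` has a non-real zero** (strict Laguerre in the Laguerre–Pólya class would give
`G(-c₀)·G''(-c₀) < 0`, but `G''(-c₀) = 0`). -/
theorem exists_nonreal_zero : ∃ w : ℂ, G c₀ K₀ w = 0 ∧ w.im ≠ 0 := by
  by_contra h
  push Not at h
  obtain ⟨A, -, hA⟩ := exists_norm_G_le c₀ K₀
  have hnc : ∃ z, deriv (G c₀ K₀) z ≠ 0 := ⟨0, by
    rw [deriv_G, coshSqrt_zero]; norm_num [c₀]⟩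
  have hx1 : deriv (G c₀ K₀) ((-c₀ : ℝ) : ℂ) = 0 := by push_cast; exact deriv_G_neg_c c₀ K₀
  have hx0 : G c₀ K₀ ((-c₀ : ℝ) : ℂ) ≠ 0 := by push_cast; exact G_neg_c₀_ne
  have key := Summit.RiemannHypothesis.RiemannHypothesis.Theorems.Splittings.JensenX4LaguerreHeredity.laguerre_sign
    (differentiable_G c₀ K₀) (ρ := 3 / 4) (C := A) (by norm_num) (by norm_num) hA (G_im_ofReal c₀ K₀) h
    hnc (-c₀) hx1 hx0
  have h2 : deriv (deriv (G c₀ K₀)) ((-c₀ : ℝ) : ℂ) = 0 := by push_cast; exact deriv_deriv_G_neg_c c₀ K₀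
  rw [h2, Complex.zero_re, mul_zero] at key
  exact lt_irrefl 0 key

/-- **`X1`-analogue**: every zero of `G'` is real. -/
theorem zeros_deriv_G_real (c K : ℝ) : ∀ w : ℂ, deriv (G c K) w = 0 → w.im = 0 := by
  intro w hw
  rw [deriv_G, mul_eq_zero] at hw
  rcases hw with h | h
  · have h2 : w + c = 0 := pow_eq_zero_iff (two_ne_zero) |>.1 h
    have : w = -(c : ℂ) := by linear_combination h2
    rw [this]; simp
  · exact (im_eq_zero_of_coshSqrt_eq_zero h).1

/-- Laguerre heredity: every zero of `G^{(l+1)}` is real. -/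
theorem zeros_real_iteratedDeriv_succ (l : ℕ) : ∀ z, iteratedDeriv (l + 1) (G c₀ K₀) z = 0 → z.im = 0 := by
  induction l with
  | zero => intro z hz; rw [zero_add, iteratedDeriv_one] at hz; exact zeros_deriv_G_real c₀ K₀ z hz
  | succ l ih =>
    have hd := Literature.Analysis.Complex.differentiable_iteratedDeriv_of_entire (differentiable_G c₀ K₀) (l + 1)
    obtain ⟨A, -, hA⟩ := exists_norm_G_le c₀ K₀
    obtain ⟨ρ, C, hρ0, hρ, hgr⟩ := Literature.Analysis.Complex.exists_growth_iteratedDeriv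
      (differentiable_G c₀ K₀) (by norm_num : (0 : ℝ) ≤ 3 / 4) (by norm_num) hA (l + 1)
    have hreal := Literature.Analysis.Complex.im_iteratedDeriv_ofReal (differentiable_G c₀ K₀) (G_im_ofReal c₀ K₀) (l + 1)
    rcases Summit.RiemannHypothesis.RiemannHypothesis.Theorems.UniversalFactor.laguerre_step hd hρ0 hρ hgr hreal ih 0
      with h | h
    · exfalso
      have h0 := h 0
      simp only [Complex.ofReal_zero, zero_mul, add_zero] at h0
      rw [← iteratedDeriv_succ] at h0
      have := (taylor_pos (l + 1 + 1)).2
      rw [h0] at this; simp at this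
    · intro z hz
      apply h z
      rw [iteratedDeriv_succ] at hz
      rw [hz]; simp

/-- **Strict Laguerre at levels `≥ 1`**: `G^{(l+1)}(x) · G^{(l+3)}(x) < 0` at real zeros `x` of
`G^{(l+2)}` with `G^{(l+1)}(x) ≠ 0`. -/
theorem laguerre_strict_level_succ (l : ℕ) (x : ℝ) (h1 : iteratedDeriv (l + 2) (G c₀ K₀) x = 0)
    (h0 : iteratedDeriv (l + 1) (G c₀ K₀) x ≠ 0) :
    (iteratedDeriv (l + 1) (G c₀ K₀) x).re * (iteratedDeriv (l + 3) (G c₀ K₀) x).re < 0 := by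
  have hd := Literature.Analysis.Complex.differentiable_iteratedDeriv_of_entire (differentiable_G c₀ K₀) (l + 1)
  obtain ⟨A, -, hA⟩ := exists_norm_G_le c₀ K₀
  obtain ⟨ρ, C, hρ0, hρ, hgr⟩ := Literature.Analysis.Complex.exists_growth_iteratedDeriv
    (differentiable_G c₀ K₀) (by norm_num : (0 : ℝ) ≤ 3 / 4) (by norm_num) hA (l + 1)
  have hreal := Literature.Analysis.Complex.im_iteratedDeriv_ofReal (differentiable_G c₀ K₀) (G_im_ofReal c₀ K₀) (l + 1)
  have hzero := zeros_real_iteratedDeriv_succ l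
  have hnc : ∃ z, deriv (iteratedDeriv (l + 1) (G c₀ K₀)) z ≠ 0 := by
    refine ⟨0, fun h ↦ ?_⟩
    rw [← iteratedDeriv_succ] at h
    have := (taylor_pos (l + 1 + 1)).2
    rw [h] at this; simp at this
  have hx1 : deriv (iteratedDeriv (l + 1) (G c₀ K₀)) x = 0 := by rw [← iteratedDeriv_succ]; exact h1
  have key := Summit.RiemannHypothesis.RiemannHypothesis.Theorems.Splittings.JensenX4LaguerreHeredity.laguerre_sign
    hd hρ0 hρ hgr hreal hzero hnc x hx1 h0
  rwa [← iteratedDeriv_succ, ← iteratedDeriv_succ] at key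

/-- **Hereditary NON-STRICT Laguerre for the real trace** (all levels; `= 0` only at level `0`,
point `-c₀`). -/
theorem hereditary_laguerre_le (l : ℕ) (x : ℝ)
    (h1 : iteratedDeriv (l + 1) (fun t : ℝ ↦ (G c₀ K₀ t).re) x = 0)
    (h0 : iteratedDeriv l (fun t : ℝ ↦ (G c₀ K₀ t).re) x ≠ 0) :
    iteratedDeriv l (fun t : ℝ ↦ (G c₀ K₀ t).re) x
      * iteratedDeriv (l + 2) (fun t : ℝ ↦ (G c₀ K₀ t).re) x ≤ 0 := by
  have hd := differentiable_G c₀ K₀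
  simp only [Literature.Analysis.Complex.KiKim.iteratedDeriv_re_ofReal hd] at h1 h0 ⊢
  have h1' : iteratedDeriv (l + 1) (G c₀ K₀) x = 0 := (iteratedDeriv_G_ofReal_eq_zero_iff c₀ K₀ _ x).2 h1
  have h0' : iteratedDeriv l (G c₀ K₀) x ≠ 0 := fun h ↦ h0 (by rw [h]; rfl)
  rcases l with _ | l
  · rw [zero_add, iteratedDeriv_one] at h1'
    have := laguerre_le_level_zero x h1'
    simpa [iteratedDeriv_succ, iteratedDeriv_zero] using this
  · exact (laguerre_strict_level_succ l x h1' h0').le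

/-! ## §11 Infinitely many real zeros -/

/-- Cast of the sea point `σ j` into `ℂ`. -/
theorem σ_cast (j : ℕ) : ((σ j : ℝ) : ℂ) = -(((2 * j + 1) * Real.pi / 2 : ℝ) : ℂ) ^ 2 := by
  simp only [σ]; push_cast; ring

/-- The sea points decrease: `σ (j+1) < σ j`. -/
theorem σ_succ_lt (j : ℕ) : σ (j + 1) < σ j := by
  simp only [σ]
  have h0 : 0 ≤ (2 * (j : ℝ) + 1) * Real.pi / 2 := (sea_pos j).le
  have hlt : (2 * (j : ℝ) + 1) * Real.pi / 2 < (2 * ((j + 1 : ℕ) : ℝ) + 1) * Real.pi / 2 := by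
    push_cast; nlinarith [Real.pi_pos]
  exact neg_lt_neg (pow_lt_pow_left₀ hlt h0 two_ne_zero)

/-- `σ` is antitone. -/
theorem σ_antitone {a b : ℕ} (h : a ≤ b) : σ b ≤ σ a := by
  simp only [σ]
  have h0 : 0 ≤ (2 * (a : ℝ) + 1) * Real.pi / 2 := (sea_pos a).le
  have hab : (a : ℝ) ≤ b := Nat.cast_le.2 h
  have hle : (2 * (a : ℝ) + 1) * Real.pi / 2 ≤ (2 * (b : ℝ) + 1) * Real.pi / 2 := by
    nlinarith [Real.pi_pos]
  exact neg_le_neg (pow_le_pow_left₀ h0 hle 2)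

/-- The real trace `t ↦ Re G(t)` is continuous. -/
theorem continuous_trace (c K : ℝ) : Continuous (fun t : ℝ ↦ (G c K t).re) :=
  Complex.continuous_re.comp ((differentiable_G c K).continuous.comp Complex.continuous_ofReal)

/-- `Re G c₀ K₀ (σ j) ≠ 0`. -/
theorem re_G_σ_ne (j : ℕ) : (G c₀ K₀ (σ j)).re ≠ 0 := by rw [σ_cast]; exact re_G_sea_ne j

/-- `g(σ_j) · g(σ_{j+1}) < 0` (alternation). -/
theorem re_G_σ_mul_succ_neg (j : ℕ) : (G c₀ K₀ (σ j)).re * (G c₀ K₀ (σ (j + 1))).re < 0 := by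
  rw [σ_cast, σ_cast]
  rcases Nat.even_or_odd j with hj | hj
  · exact mul_neg_of_neg_of_pos (re_G_sea_neg_of_even hj) (re_G_sea_pos_of_odd hj.add_one)
  · exact mul_neg_of_pos_of_neg (re_G_sea_pos_of_odd hj) (re_G_sea_neg_of_even hj.add_one)

/-- A real zero of `G` strictly between consecutive sea points. -/
theorem exists_zero_between (j : ℕ) : ∃ y : ℝ, σ (j + 1) < y ∧ y < σ j ∧ (G c₀ K₀ y).re = 0 := by
  have hcont : ContinuousOn (fun t : ℝ ↦ (G c₀ K₀ t).re) (Set.uIcc (σ (j + 1)) (σ j)) :=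
    (continuous_trace _ _).continuousOn
  have hprod := re_G_σ_mul_succ_neg j
  have h0 : (0 : ℝ) ∈ Set.uIcc ((fun t : ℝ ↦ (G c₀ K₀ t).re) (σ (j + 1))) ((fun t : ℝ ↦ (G c₀ K₀ t).re) (σ j)) := by
    rw [Set.mem_uIcc]
    rcases le_or_gt ((G c₀ K₀ (σ (j + 1))).re) 0 with h | h
    · exact Or.inl ⟨h, by nlinarith⟩
    · exact Or.inr ⟨by nlinarith, h.le⟩
  obtain ⟨y, hy, hy0⟩ := intermediate_value_uIcc hcont h0
  rw [Set.uIcc_of_le (σ_succ_lt j).le] at hy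
  refine ⟨y, lt_of_le_of_ne hy.1 ?_, lt_of_le_of_ne hy.2 ?_, hy0⟩
  · rintro h; rw [← h] at hy0; exact re_G_σ_ne (j + 1) hy0
  · rintro h; rw [h] at hy0; exact re_G_σ_ne j hy0

/-- **`G_{c₀,K₀}` has infinitely many real zeros.** -/
theorem infinite_real_zeros : {w : ℂ | G c₀ K₀ w = 0 ∧ w.im = 0}.Infinite := by
  choose y hy using exists_zero_between
  have hinj : Function.Injective y := by
    intro j k hjk
    by_contra hne
    rcases lt_or_gt_of_ne hne with h | h
    · have h1 : σ k ≤ σ (j + 1) := σ_antitone (by omega)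
      linarith [(hy k).2.1, (hy j).1]
    · have h1 : σ j ≤ σ (k + 1) := σ_antitone (by omega)
      linarith [(hy j).2.1, (hy k).1]
  refine Set.infinite_of_injective_forall_mem (f := fun j ↦ ((y j : ℝ) : ℂ))
    (fun j k h ↦ hinj (by have h' : ((y j : ℝ) : ℂ) = ((y k : ℝ) : ℂ) := h; exact_mod_cast h'))
    fun j ↦ ⟨?_, ?_⟩
  · exact (G_ofReal_eq_zero_iff _ _ _).2 (hy j).2.2
  · exact Complex.ofReal_im _

/-! ## §12 Jensen polynomials: rows `n ≥ 1` hyperbolic, `¬ AllHyperbolic` -/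

/-- **`RowsFromOne`-analogue**: every `J^{d,n}(G)` with `n ≥ 1` is hyperbolic (any `c > 0`, any `K`). -/
theorem splits_jensenPoly_G {c : ℝ} (hc : 0 < c) (K : ℝ) {n : ℕ} (hn : 1 ≤ n) (d : ℕ) :
    (jensenPoly (taylorCoeffSeq (G c K)) d n).Splits := by
  obtain ⟨m, rfl⟩ := Nat.exists_eq_add_of_le' hn
  rw [jensenPoly_taylorCoeffSeq_succ, deriv_G_eq_Fw]
  refine Literature.Analysis.Complex.PolyaSchur.splits_jensenPoly_taylor_of_zeros_real
    (isEntireOfOrderLtOne_Fw c 0) (by rw [Fw_zero, Complex.ofReal_im]) ?_ ?_ d m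
  · rw [Fw_zero, Complex.ofReal_ne_zero]; positivity
  · intro z hz
    rcases (Fw_eq_zero_iff c 0 z).1 hz with (rfl | rfl) | h
    · simp
    · simp
    · exact (im_eq_zero_of_coshSqrt_eq_zero h).1

/-- For `c > 0` the Taylor sequence of `G c K` is eventually hyperbolic (rows `n ≥ 1`). -/
theorem eventuallyHyperbolic_G {c : ℝ} (hc : 0 < c) (K : ℝ) : EventuallyHyperbolic (taylorCoeffSeq (G c K)) :=
  fun d _ ↦ ⟨1, fun _ hn ↦ splits_jensenPoly_G hc K hn d⟩

/-- **`¬ AllHyperbolic`**: some row-`0` Jensen polynomial of `G_{c₀,K₀}` is not hyperbolic. -/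
theorem not_allHyperbolic_G : ¬ AllHyperbolic (taylorCoeffSeq (G c₀ K₀)) := by
  intro h
  obtain ⟨w, hw, hwim⟩ := exists_nonreal_zero
  exact hwim (im_eq_zero_of_forall_splits_taylorCoeffSeq (differentiable_G _ _) (G_conj _ _)
    G_zero_ne (fun d ↦ h d 0) hw)

/-- Some row-`0` Jensen polynomial of `G c₀ K₀` is not hyperbolic. -/
theorem exists_not_splits_jensenPoly_G_zero : ∃ d : ℕ, ¬ (jensenPoly (taylorCoeffSeq (G c₀ K₀)) d 0).Splits := by
  by_contra h
  push Not at h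
  exact not_allHyperbolic_G fun d n ↦ by
    rcases Nat.eq_zero_or_pos n with rfl | hn
    · exact h d
    · exact splits_jensenPoly_G c₀_pos K₀ hn d

/-! ## §13 The packaged witness and the refuted schemata -/

/-- **THE WITNESS.** `G = G_{c₀,K₀}` is real entire of order `< 1` with positive Taylor data and
`G(0) ≠ 0`; every zero of `G'` is real (`X1`-analogue); the real trace satisfies the hereditary
NON-STRICT Laguerre inequalities; `G'(-c₀) = G''(-c₀) = 0 < G(-c₀)` (a degenerate critical point);
every Jensen row `n ≥ 1` is hyperbolic (`RowsFromOne`-analogue), `EventuallyHyperbolic`; `G` has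
infinitely many real zeros AND a non-real zero, `¬ AllHyperbolic`. -/
theorem degenerateShadowWitness :
    ∃ F : ℂ → ℂ,
      IsEntireOfOrderLt 1 F ∧ IsEntireOfOrderLtOne F ∧ F 0 ≠ 0 ∧ (∀ x : ℝ, (F x).im = 0) ∧
      (∀ k : ℕ, (iteratedDeriv k F 0).im = 0 ∧ 0 < (iteratedDeriv k F 0).re) ∧
      (∀ w : ℂ, deriv F w = 0 → w.im = 0) ∧
      (∀ (l : ℕ) (x : ℝ), iteratedDeriv (l + 1) (fun t : ℝ ↦ (F t).re) x = 0 →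
          iteratedDeriv l (fun t : ℝ ↦ (F t).re) x ≠ 0 →
          iteratedDeriv l (fun t : ℝ ↦ (F t).re) x * iteratedDeriv (l + 2) (fun t : ℝ ↦ (F t).re) x ≤ 0) ∧
      (∃ x : ℝ, deriv (fun t : ℝ ↦ (F t).re) x = 0 ∧ iteratedDeriv 2 (fun t : ℝ ↦ (F t).re) x = 0 ∧
          0 < (F x).re) ∧
      ¬ HasNoFourierCriticalPoint (fun t : ℝ ↦ (F t).re) ∧
      (∀ d n : ℕ, 1 ≤ n → (jensenPoly (taylorCoeffSeq F) d n).Splits) ∧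
      EventuallyHyperbolic (taylorCoeffSeq F) ∧
      {w : ℂ | F w = 0 ∧ w.im = 0}.Infinite ∧
      (∃ w : ℂ, F w = 0 ∧ w.im ≠ 0) ∧
      ¬ AllHyperbolic (taylorCoeffSeq F) :=
  ⟨G c₀ K₀, isEntireOfOrderLt_one_G _ _, isEntireOfOrderLtOne_G _ _, G_zero_ne, G_im_ofReal _ _, taylor_pos,
    zeros_deriv_G_real _ _, hereditary_laguerre_le, ⟨-c₀, degenerate_point⟩,
    not_hasNoFourierCriticalPoint_trace, fun d _ hn ↦ splits_jensenPoly_G c₀_pos K₀ hn d,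
    eventuallyHyperbolic_G c₀_pos K₀, infinite_real_zeros, exists_nonreal_zero, not_allHyperbolic_G⟩

/-- **REFUTED (function level): the NON-STRICT twin of Ki–Kim's Theorem 4.1**
(`KiKim.im_eq_zero_of_noCrit_of_order_lt_one` with `<` weakened to `≤`), even with the extra
hypotheses «all Taylor coefficients positive», «infinitely many real zeros» and «every zero of `F'` is
real» (which exclude the elementary polynomial witnesses such as `x⁴/4 + 5x³/3 + 7x²/2 + 3x + 1`,
whose derivative `(x+1)²(x+3)` has the same degenerate-critical-point mechanism). -/
theorem not_nonStrictLaguerre_implies_realZeros :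
    ¬ (∀ F : ℂ → ℂ, IsEntireOfOrderLt 1 F → F 0 ≠ 0 → (∀ x : ℝ, (F x).im = 0) →
        (∀ k : ℕ, 0 < (iteratedDeriv k F 0).re) →
        {w : ℂ | F w = 0 ∧ w.im = 0}.Infinite →
        (∀ w : ℂ, deriv F w = 0 → w.im = 0) →
        (∀ (l : ℕ) (x : ℝ), iteratedDeriv (l + 1) (fun t : ℝ ↦ (F t).re) x = 0 →
            iteratedDeriv l (fun t : ℝ ↦ (F t).re) x ≠ 0 →
            iteratedDeriv l (fun t : ℝ ↦ (F t).re) x * iteratedDeriv (l + 2) (fun t : ℝ ↦ (F t).re) x ≤ 0) →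
        ∀ w : ℂ, F w = 0 → w.im = 0) := by
  intro h
  obtain ⟨w, hw, hwim⟩ := exists_nonreal_zero
  exact hwim (h (G c₀ K₀) (isEntireOfOrderLt_one_G _ _) G_zero_ne (G_im_ofReal _ _) (fun k ↦ (taylor_pos k).2)
    infinite_real_zeros (zeros_deriv_G_real _ _) hereditary_laguerre_le w hw)

/-- … whereas the STRICT version is the tree's theorem (Ki–Kim 2000, Thm 4.1). -/
theorem strictLaguerre_implies_realZeros (F : ℂ → ℂ) (hF : IsEntireOfOrderLt 1 F) (h0 : F 0 ≠ 0)
    (hreal : ∀ x : ℝ, (F x).im = 0) (hH : HasNoFourierCriticalPoint (fun t : ℝ ↦ (F t).re)) :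
    ∀ w : ℂ, F w = 0 → w.im = 0 :=
  Literature.Analysis.Complex.KiKim.im_eq_zero_of_noCrit_of_order_lt_one hF h0 hreal hH

/-- **REFUTED (Jensen level, the `X-4` shadow): `RowsFromOne ∧ (non-strict RowZero-Laguerre at the
function level) ⟹ AllHyperbolic` fails in the class** of real entire functions of order `< 1` with
positive Taylor coefficients and infinitely many real zeros, even adding «zeros of `F'` real». -/
theorem not_rowsFromOne_and_nonStrictLaguerre_implies_allHyperbolic :
    ¬ (∀ F : ℂ → ℂ, IsEntireOfOrderLtOne F →
        (∀ k : ℕ, (iteratedDeriv k F 0).im = 0 ∧ 0 < (iteratedDeriv k F 0).re) →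
        {w : ℂ | F w = 0 ∧ w.im = 0}.Infinite →
        (∀ d n : ℕ, 1 ≤ n → (jensenPoly (taylorCoeffSeq F) d n).Splits) →
        (∀ w : ℂ, deriv F w = 0 → w.im = 0) →
        (∀ (l : ℕ) (x : ℝ), iteratedDeriv (l + 1) (fun t : ℝ ↦ (F t).re) x = 0 →
            iteratedDeriv l (fun t : ℝ ↦ (F t).re) x ≠ 0 →
            iteratedDeriv l (fun t : ℝ ↦ (F t).re) x * iteratedDeriv (l + 2) (fun t : ℝ ↦ (F t).re) x ≤ 0) →
        AllHyperbolic (taylorCoeffSeq F)) := fun h ↦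
  not_allHyperbolic_G (h (G c₀ K₀) (isEntireOfOrderLtOne_G _ _) taylor_pos infinite_real_zeros
    (fun d _ hn ↦ splits_jensenPoly_G c₀_pos K₀ hn d) (zeros_deriv_G_real _ _) hereditary_laguerre_le)

end Summit.RiemannHypothesis.RiemannHypothesis.Theorems.Splittings.JensenDegenerateCritical
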